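import Summits.ValiantsHypothesis.ValiantsHypothesis.Theorems.BarrierLeverFreePairKernelNonsingular

/-!
# Route BarrierLever — item `ChowHitsThinRowPartitionMinors` (stmt-ValiantsHypothesis-20195):
# a DOWN-CLOSED MONOMIAL BASIS for an arbitrary family of columns (prelims for the all-columns
# first-order-rows slice, I)

Helper file (`--supports stmt-ValiantsHypothesis-20195`; cell valiant-natproofs, rung V4, 𝒟-side of
door (c); prover seat val-np-p7 gen 4).  Closes NO item; no definitions; imports only `…FreePairKernelNonsingular` (val-np-p2), for
`FreePairKernel.code_injective` (binary codes of subsets are injective).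

**Theorem `exists_downClosed_monomialBasis`.**  For every injective family of columns
`w : Fin r → Finset (Fin h)` (an `r`-subset `W` of the cube `{0,1}^h`) there is an injective family
`U : Fin r → Finset (Fin h)` with DOWN-CLOSED image (every subset of a `U i` is a `U i'`) such that the
square `0/1` matrix `Z i j = [U i ⊆ w j]` — the monomials `z_{U i} = ∏_{c ∈ U i} z_c` evaluated at the
points `1_{w j}` — has nonzero determinant.  In words: the functions on ANY finite point set `W` of the
cube admit a basis of square-free monomials indexed by a down-closed family (an order ideal) `Δ(W)`
with `|Δ(W)| = |W|`.

This is the combinatorial input of the all-columns first-order-rows slice of item 20195 (memo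
MEMO-CPM-s1-UDC-v6, val-np-p7 g4): the Chow witness for a layout with columns `W` is the product of
the (scaled) indicator forms of `Δ(W)`, generalising prover g10's
`ChowSubcube.chowHits_firstOrderRows_of_downClosed` (there `W` itself is down-closed and `Δ(W) = W`).

Mechanism (= the standard monomials of the ideal of the point set `W` for a degree-compatible term
order, done by plain linear algebra).  Throughout, the MONOMIAL VECTOR of `S` is
`j ↦ [S ⊆ w j] ∈ ℂ^r` and the ORDER KEY of `S` is `|S|·2^h + Σ_{c∈S} 2^c` (size first, then binary
encoding; injective, `key_injective`, via `FreePairKernel.code_injective`).  Call `S` NON-STANDARD when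
its monomial vector lies in the span
of the monomial vectors of sets with strictly smaller key.  The standard sets span (induction along the
key, using that ALL monomial vectors span: inclusion–exclusion `e_j = Σ_{A ⊆ (w j)ᶜ} (-1)^{|A|} z_{w j ∪ A}`,
`single_eq_sum_monomialVec`), are linearly independent (a dependency exhibits its key-maximal member as
non-standard, `std_linearIndependent`), hence number exactly `r` (`card_std`); and they form a
down-closed family because `z_{T ∪ M} = z_T · z_M` pointwise and the key is additive over disjoint
unions (`key_union_lt`), so a superset of a non-standard set is non-standard (`nonStd_mono`).

WHAT THIS IS NOT: nothing here on items 20195 / 20172 / 19717 themselves, on crux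
stmt-ValiantsHypothesis-14610, or on `VP` versus `VNP`.
-/

set_option linter.dupNamespace false

namespace Summit.ValiantsHypothesis.ValiantsHypothesis.Theorems.BarrierLever.ChowThinAll

open Finset

variable {h r : ℕ}

/-! ## 1. The order key `|S|·2^h + Σ_{c ∈ S} 2^c` on subsets of `Fin h` -/

/-- The binary encoding `Σ_{c ∈ S} 2^c` of a subset of `Fin h` is `< 2^h`. -/
theorem enc_lt (S : Finset (Fin h)) : ∑ c ∈ S, 2 ^ (c : ℕ) < 2 ^ h := by
  have e : ∑ c ∈ S, 2 ^ (c : ℕ) = ∑ k ∈ S.map Fin.valEmbedding, 2 ^ k := by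
    rw [Finset.sum_map]
    rfl
  rw [e]
  exact Nat.geomSum_lt (le_refl 2) (fun k hk => by
    obtain ⟨c, -, rfl⟩ := Finset.mem_map.mp hk
    exact c.isLt)

/-- The binary encoding is additive over disjoint unions. -/
theorem enc_union_of_disjoint {S M : Finset (Fin h)} (hd : Disjoint S M) :
    ∑ c ∈ S ∪ M, 2 ^ (c : ℕ) = ∑ c ∈ S, 2 ^ (c : ℕ) + ∑ c ∈ M, 2 ^ (c : ℕ) :=
  Finset.sum_union hd

/-- The order key `|S|·2^h + Σ_{c∈S} 2^c` is injective (a linear order on the subsets). -/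
theorem key_injective :
    Function.Injective (fun S : Finset (Fin h) => S.card * 2 ^ h + ∑ c ∈ S, 2 ^ (c : ℕ)) := by
  intro S T e
  have hS := enc_lt S
  have hT := enc_lt T
  simp only at e
  have key_div : ∀ X : Finset (Fin h), (X.card * 2 ^ h + ∑ c ∈ X, 2 ^ (c : ℕ)) / 2 ^ h = X.card := by
    intro X
    rw [show X.card * 2 ^ h + ∑ c ∈ X, 2 ^ (c : ℕ) = (∑ c ∈ X, 2 ^ (c : ℕ)) + 2 ^ h * X.card by ring,
      Nat.add_mul_div_left _ _ (by positivity), Nat.div_eq_of_lt (enc_lt X), zero_add]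
  have hc : S.card = T.card := by
    have h1 := key_div S
    have h2 := key_div T
    rw [e] at h1
    exact h1.symm.trans h2
  rw [hc] at e
  exact FreePairKernel.code_injective (by simpa using e)

/-- A strictly smaller set has a strictly smaller key. -/
theorem key_lt_of_card_lt {S T : Finset (Fin h)} (hc : S.card < T.card) :
    S.card * 2 ^ h + ∑ c ∈ S, 2 ^ (c : ℕ) < T.card * 2 ^ h + ∑ c ∈ T, 2 ^ (c : ℕ) := by
  have hS := enc_lt S
  calc S.card * 2 ^ h + ∑ c ∈ S, 2 ^ (c : ℕ) < S.card * 2 ^ h + 2 ^ h := by omega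
    _ = (S.card + 1) * 2 ^ h := by ring
    _ ≤ T.card * 2 ^ h := Nat.mul_le_mul_right _ hc
    _ ≤ T.card * 2 ^ h + ∑ c ∈ T, 2 ^ (c : ℕ) := Nat.le_add_right _ _

/-- A set with a smaller key is not larger. -/
theorem card_le_of_key_lt {S T : Finset (Fin h)}
    (hlt : S.card * 2 ^ h + ∑ c ∈ S, 2 ^ (c : ℕ) < T.card * 2 ^ h + ∑ c ∈ T, 2 ^ (c : ℕ)) :
    S.card ≤ T.card := by
  by_contra hc
  exact absurd (key_lt_of_card_lt (not_le.mp hc)) (not_lt.mpr hlt.le)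

/-- **Shift lemma**: the key order is preserved under union with a set disjoint from the later set
(the degree-compatible term-order property behind down-closedness). -/
theorem key_union_lt {T T' M : Finset (Fin h)}
    (hlt : T'.card * 2 ^ h + ∑ c ∈ T', 2 ^ (c : ℕ) < T.card * 2 ^ h + ∑ c ∈ T, 2 ^ (c : ℕ))
    (hTM : Disjoint T M) :
    (T' ∪ M).card * 2 ^ h + ∑ c ∈ T' ∪ M, 2 ^ (c : ℕ) <
      (T ∪ M).card * 2 ^ h + ∑ c ∈ T ∪ M, 2 ^ (c : ℕ) := by
  rcases Nat.lt_or_ge (T' ∪ M).card (T ∪ M).card with hc | hc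
  · exact key_lt_of_card_lt hc
  · have h1 : (T ∪ M).card = T.card + M.card := Finset.card_union_of_disjoint hTM
    have h2 : (T' ∪ M).card ≤ T'.card + M.card := Finset.card_union_le _ _
    have h3 : T'.card ≤ T.card := card_le_of_key_lt hlt
    have h4 : (T' ∪ M).card = T'.card + M.card := by omega
    have hd' : Disjoint T' M := Finset.card_union_eq_card_add_card.mp h4
    have h5 : T'.card = T.card := by omega
    rw [h4, h1, enc_union_of_disjoint hd', enc_union_of_disjoint hTM, h5]
    rw [h5] at hlt
    omega

/-! ## 2. Monomial vectors `j ↦ [S ⊆ w j]` on the columns -/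

/-- `z_{S ∪ M} = z_S · z_M` pointwise on the cube: the monomial vector of a union is the pointwise
product. -/
theorem monomialVec_union (w : Fin r → Finset (Fin h)) (S M : Finset (Fin h)) :
    (fun j : Fin r => if S ∪ M ⊆ w j then (1 : ℂ) else 0) =
      (fun j : Fin r => if S ⊆ w j then (1 : ℂ) else 0) * (fun j : Fin r => if M ⊆ w j then (1 : ℂ) else 0) := by
  funext j
  simp only [Pi.mul_apply, Finset.union_subset_iff]
  by_cases hS : S ⊆ w j <;> by_cases hM : M ⊆ w j <;> simp [hS, hM]

/-- Inclusion–exclusion: `Σ_{A ⊆ D} (-1)^{|A|} = [D = ∅]` in `ℂ`. -/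
theorem sum_powerset_neg_one_pow (D : Finset (Fin h)) :
    ∑ A ∈ D.powerset, (-1 : ℂ) ^ A.card = if D = ∅ then 1 else 0 := by
  have e := (Finset.sum_powerset_neg_one_pow_card (x := D))
  by_cases hD : D = ∅
  · rw [if_pos hD] at e
    rw [if_pos hD]
    exact_mod_cast e
  · rw [if_neg hD] at e
    rw [if_neg hD]
    exact_mod_cast e

/-- **All monomial vectors span**: every coordinate vector is the inclusion–exclusion combination
`e_j = Σ_{A ⊆ (w j)ᶜ} (-1)^{|A|} z_{w j ∪ A}` of monomial vectors (columns injective). -/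
theorem single_eq_sum_monomialVec (w : Fin r → Finset (Fin h)) (hw : Function.Injective w)
    (j : Fin r) :
    (Pi.single j (1 : ℂ) : Fin r → ℂ) =
      ∑ A ∈ (w j)ᶜ.powerset, ((-1 : ℂ) ^ A.card) • (fun j' : Fin r => if w j ∪ A ⊆ w j' then (1 : ℂ) else 0) := by
  funext j'
  simp only [Finset.sum_apply, Pi.smul_apply, smul_eq_mul]
  by_cases h1 : w j ⊆ w j'
  · have hterm : ∀ A ∈ (w j)ᶜ.powerset, ((-1 : ℂ) ^ A.card * if w j ∪ A ⊆ w j' then 1 else 0) =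
        if A ⊆ w j' then (-1 : ℂ) ^ A.card else 0 := by
      intro A _
      by_cases h2 : A ⊆ w j' <;> simp [h1, h2, Finset.union_subset_iff]
    rw [Finset.sum_congr rfl hterm, ← Finset.sum_filter]
    have hfil : (w j)ᶜ.powerset.filter (fun A => A ⊆ w j') = ((w j)ᶜ ∩ w j').powerset := by
      ext A
      rw [Finset.mem_filter, Finset.mem_powerset, Finset.mem_powerset, Finset.subset_inter_iff]
    rw [hfil, sum_powerset_neg_one_pow]
    by_cases hjj : j = j'
    · subst hjj
      have h0 : (w j)ᶜ ∩ w j = ∅ := by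
        ext c
        simp
      rw [h0]
      simp
    · have hne : (w j)ᶜ ∩ w j' ≠ ∅ := by
        intro h0
        apply hjj
        apply hw
        refine le_antisymm h1 fun c hc => ?_
        by_contra hcn
        have hc' : c ∈ (w j)ᶜ ∩ w j' := Finset.mem_inter.mpr ⟨Finset.mem_compl.mpr hcn, hc⟩
        rw [h0] at hc'
        exact absurd hc' (Finset.notMem_empty c)
      rw [if_neg hne, Pi.single_apply, if_neg (Ne.symm hjj)]
  · have hterm : ∀ A ∈ (w j)ᶜ.powerset,
        ((-1 : ℂ) ^ A.card * if w j ∪ A ⊆ w j' then 1 else 0) = 0 := by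
      intro A _
      have hn : ¬ (w j ∪ A ⊆ w j') := fun hh => h1 (Finset.union_subset_left hh)
      simp [hn]
    rw [Finset.sum_congr rfl hterm, Finset.sum_const_zero]
    have hjj : j' ≠ j := fun e => h1 (e ▸ subset_refl _)
    rw [Pi.single_apply, if_neg hjj]

/-- Hence the monomial vectors span all of `ℂ^r`. -/
theorem span_monomialVec_eq_top (w : Fin r → Finset (Fin h)) (hw : Function.Injective w) :
    Submodule.span ℂ (Set.range fun S : Finset (Fin h) => fun j : Fin r => if S ⊆ w j then (1 : ℂ) else 0) = ⊤ := by
  rw [Submodule.eq_top_iff']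
  intro f
  rw [← Finset.univ_sum_single f]
  refine Submodule.sum_mem _ fun j _ => ?_
  have e : Pi.single j (f j) = (f j) • (Pi.single j (1 : ℂ) : Fin r → ℂ) := by
    rw [← Pi.single_smul, smul_eq_mul, mul_one]
  rw [e, single_eq_sum_monomialVec w hw j]
  refine Submodule.smul_mem _ _ (Submodule.sum_mem _ fun A _ => ?_)
  exact Submodule.smul_mem _ _ (Submodule.subset_span ⟨w j ∪ A, rfl⟩)

/-! ## 3. Standard and non-standard sets (greedy basis along the key)

`T` is NON-STANDARD for the columns `w` when its monomial vector lies in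
`Submodule.span ℂ (monomial vectors of the sets with strictly smaller key)`; we spell this
membership out in every statement (no auxiliary definition). -/

/-- **Non-standard sets form an up-set** (so standard sets form a DOWN-CLOSED family): if the
monomial vector of `T` is a combination of those of earlier sets, so is the monomial vector of every
`S ⊇ T` — multiply pointwise by `z_{S ∖ T}` and use the shift lemma. -/
theorem nonStd_mono (w : Fin r → Finset (Fin h)) {T S : Finset (Fin h)}
    (hT : (fun j : Fin r => if T ⊆ w j then (1 : ℂ) else 0) ∈ Submodule.span ℂ
      ((fun S' : Finset (Fin h) => fun j : Fin r => if S' ⊆ w j then (1 : ℂ) else 0) ''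
        {T' | T'.card * 2 ^ h + ∑ c ∈ T', 2 ^ (c : ℕ) < T.card * 2 ^ h + ∑ c ∈ T, 2 ^ (c : ℕ)}))
    (hTS : T ⊆ S) :
    (fun j : Fin r => if S ⊆ w j then (1 : ℂ) else 0) ∈ Submodule.span ℂ
      ((fun S' : Finset (Fin h) => fun j : Fin r => if S' ⊆ w j then (1 : ℂ) else 0) ''
        {T' | T'.card * 2 ^ h + ∑ c ∈ T', 2 ^ (c : ℕ) < S.card * 2 ^ h + ∑ c ∈ S, 2 ^ (c : ℕ)}) := by
  set M := S \ T with hM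
  have hTM : Disjoint T M := Finset.disjoint_sdiff
  have hS : S = T ∪ M := (Finset.union_sdiff_of_subset hTS).symm
  -- pointwise multiplication by `z_M` is linear and maps earlier-than-`T` to earlier-than-`S`
  have hmap : (fun j : Fin r => if S ⊆ w j then (1 : ℂ) else 0) =
      LinearMap.mulRight ℂ (fun j : Fin r => if M ⊆ w j then (1 : ℂ) else 0)
        (fun j : Fin r => if T ⊆ w j then (1 : ℂ) else 0) := by
    rw [LinearMap.mulRight_apply, ← monomialVec_union, ← hS]
  rw [hmap]
  have hin := Submodule.mem_map_of_mem
    (f := LinearMap.mulRight ℂ (fun j : Fin r => if M ⊆ w j then (1 : ℂ) else 0)) hT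
  rw [Submodule.map_span] at hin
  refine Submodule.span_mono ?_ hin
  rintro _ ⟨_, ⟨T', hT', rfl⟩, rfl⟩
  refine ⟨T' ∪ M, ?_, ?_⟩
  · change (T' ∪ M).card * 2 ^ h + ∑ c ∈ T' ∪ M, 2 ^ (c : ℕ) < S.card * 2 ^ h + ∑ c ∈ S, 2 ^ (c : ℕ)
    rw [hS]
    exact key_union_lt hT' hTM
  · simp only [LinearMap.mulRight_apply, monomialVec_union]

/-- Every monomial vector is a combination of STANDARD monomial vectors of no larger key
(induction along the key). -/
theorem monomialVec_mem_span_std (w : Fin r → Finset (Fin h)) (S : Finset (Fin h)) :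
    (fun j : Fin r => if S ⊆ w j then (1 : ℂ) else 0) ∈ Submodule.span ℂ
      ((fun S' : Finset (Fin h) => fun j : Fin r => if S' ⊆ w j then (1 : ℂ) else 0) ''
        {T | (fun j : Fin r => if T ⊆ w j then (1 : ℂ) else 0) ∉ Submodule.span ℂ
            ((fun S' : Finset (Fin h) => fun j : Fin r => if S' ⊆ w j then (1 : ℂ) else 0) ''
              {T' | T'.card * 2 ^ h + ∑ c ∈ T', 2 ^ (c : ℕ) < T.card * 2 ^ h + ∑ c ∈ T, 2 ^ (c : ℕ)}) ∧
          T.card * 2 ^ h + ∑ c ∈ T, 2 ^ (c : ℕ) ≤ S.card * 2 ^ h + ∑ c ∈ S, 2 ^ (c : ℕ)}) := by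
  induction hn : S.card * 2 ^ h + ∑ c ∈ S, 2 ^ (c : ℕ) using Nat.strong_induction_on generalizing S with
  | _ n ih =>
    by_cases hS : (fun j : Fin r => if S ⊆ w j then (1 : ℂ) else 0) ∈ Submodule.span ℂ
        ((fun S' : Finset (Fin h) => fun j : Fin r => if S' ⊆ w j then (1 : ℂ) else 0) ''
          {T' | T'.card * 2 ^ h + ∑ c ∈ T', 2 ^ (c : ℕ) < S.card * 2 ^ h + ∑ c ∈ S, 2 ^ (c : ℕ)})
    · refine (Submodule.span_le.mpr ?_) hS
      rintro _ ⟨T', hT', rfl⟩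
      have hlt : T'.card * 2 ^ h + ∑ c ∈ T', 2 ^ (c : ℕ) < S.card * 2 ^ h + ∑ c ∈ S, 2 ^ (c : ℕ) := hT'
      have hm := ih _ (lt_of_lt_of_eq hlt hn) T' rfl
      refine Submodule.span_mono (Set.image_mono fun T hT => ?_) hm
      exact ⟨hT.1, hT.2.trans (hlt.le.trans hn.le)⟩
    · exact Submodule.subset_span (Set.mem_image_of_mem _ ⟨hS, hn.le⟩)

/-- The standard monomial vectors span `ℂ^r`. -/
theorem span_std_eq_top (w : Fin r → Finset (Fin h)) (hw : Function.Injective w) :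
    Submodule.span ℂ
      ((fun S' : Finset (Fin h) => fun j : Fin r => if S' ⊆ w j then (1 : ℂ) else 0) ''
        {T | (fun j : Fin r => if T ⊆ w j then (1 : ℂ) else 0) ∉ Submodule.span ℂ
            ((fun S' : Finset (Fin h) => fun j : Fin r => if S' ⊆ w j then (1 : ℂ) else 0) ''
              {T' | T'.card * 2 ^ h + ∑ c ∈ T', 2 ^ (c : ℕ) < T.card * 2 ^ h + ∑ c ∈ T, 2 ^ (c : ℕ)})}) = ⊤ := by
  apply le_antisymm le_top
  rw [← span_monomialVec_eq_top w hw]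
  refine Submodule.span_le.mpr ?_
  rintro _ ⟨S, rfl⟩
  exact Submodule.span_mono (Set.image_mono fun T hT => hT.1) (monomialVec_mem_span_std w S)

open Classical in
/-- The standard monomial vectors are linearly independent: in a dependency, the member with the
largest key would be non-standard. -/
theorem std_linearIndependent (w : Fin r → Finset (Fin h)) :
    LinearIndependent ℂ (fun T : {T : Finset (Fin h) //
        (fun j : Fin r => if T ⊆ w j then (1 : ℂ) else 0) ∉ Submodule.span ℂ
          ((fun S' : Finset (Fin h) => fun j : Fin r => if S' ⊆ w j then (1 : ℂ) else 0) ''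
            {T' | T'.card * 2 ^ h + ∑ c ∈ T', 2 ^ (c : ℕ) < T.card * 2 ^ h + ∑ c ∈ T, 2 ^ (c : ℕ)})} =>
      fun j : Fin r => if T.1 ⊆ w j then (1 : ℂ) else 0) := by
  rw [Fintype.linearIndependent_iff]
  intro g hg
  by_contra hne
  obtain ⟨i₁, hi₁⟩ := not_forall.mp hne
  -- the key-maximal index with a nonzero coefficient
  obtain ⟨T₀, hT₀mem, hT₀max⟩ := Finset.exists_max_image (Finset.univ.filter fun i => g i ≠ 0)
    (fun i => i.1.card * 2 ^ h + ∑ c ∈ i.1, 2 ^ (c : ℕ))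
    ⟨i₁, Finset.mem_filter.mpr ⟨Finset.mem_univ _, hi₁⟩⟩
  have hg0 : g T₀ ≠ 0 := (Finset.mem_filter.mp hT₀mem).2
  apply T₀.2
  -- isolate the `T₀` term of the dependency
  rw [← Finset.add_sum_erase _ _ (Finset.mem_univ T₀)] at hg
  have e : (fun j : Fin r => if T₀.1 ⊆ w j then (1 : ℂ) else 0) =
      -(g T₀)⁻¹ • ∑ i ∈ Finset.univ.erase T₀, g i • (fun j : Fin r => if i.1 ⊆ w j then (1 : ℂ) else 0) := by
    have e1 : g T₀ • (fun j : Fin r => if T₀.1 ⊆ w j then (1 : ℂ) else 0) =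
        -∑ i ∈ Finset.univ.erase T₀, g i • (fun j : Fin r => if i.1 ⊆ w j then (1 : ℂ) else 0) :=
      eq_neg_of_add_eq_zero_left hg
    calc (fun j : Fin r => if T₀.1 ⊆ w j then (1 : ℂ) else 0)
        = (g T₀)⁻¹ • (g T₀ • (fun j : Fin r => if T₀.1 ⊆ w j then (1 : ℂ) else 0)) := by
          rw [smul_smul, inv_mul_cancel₀ hg0, one_smul]
      _ = _ := by rw [e1, smul_neg, neg_smul]
  rw [e]
  refine Submodule.smul_mem _ _ (Submodule.sum_mem _ fun i hi => ?_)
  by_cases hgi : g i = 0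
  · rw [hgi, zero_smul]
    exact Submodule.zero_mem _
  · refine Submodule.smul_mem _ _ (Submodule.subset_span ⟨i.1, ?_, rfl⟩)
    have hle : i.1.card * 2 ^ h + ∑ c ∈ i.1, 2 ^ (c : ℕ) ≤ T₀.1.card * 2 ^ h + ∑ c ∈ T₀.1, 2 ^ (c : ℕ) :=
      hT₀max i (Finset.mem_filter.mpr ⟨Finset.mem_univ _, hgi⟩)
    have hne' : i.1.card * 2 ^ h + ∑ c ∈ i.1, 2 ^ (c : ℕ) ≠ T₀.1.card * 2 ^ h + ∑ c ∈ T₀.1, 2 ^ (c : ℕ) :=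
      fun e' => (Finset.mem_erase.mp hi).1 (Subtype.ext (key_injective e'))
    exact lt_of_le_of_ne hle hne'

open Classical in
/-- There are exactly `r` standard sets (they index a basis of `ℂ^r`). -/
theorem card_std (w : Fin r → Finset (Fin h)) (hw : Function.Injective w) :
    Fintype.card {T : Finset (Fin h) //
        (fun j : Fin r => if T ⊆ w j then (1 : ℂ) else 0) ∉ Submodule.span ℂ
          ((fun S' : Finset (Fin h) => fun j : Fin r => if S' ⊆ w j then (1 : ℂ) else 0) ''
            {T' | T'.card * 2 ^ h + ∑ c ∈ T', 2 ^ (c : ℕ) < T.card * 2 ^ h + ∑ c ∈ T, 2 ^ (c : ℕ)})} = r := by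
  have hsp : ⊤ ≤ Submodule.span ℂ (Set.range fun T : {T : Finset (Fin h) //
        (fun j : Fin r => if T ⊆ w j then (1 : ℂ) else 0) ∉ Submodule.span ℂ
          ((fun S' : Finset (Fin h) => fun j : Fin r => if S' ⊆ w j then (1 : ℂ) else 0) ''
            {T' | T'.card * 2 ^ h + ∑ c ∈ T', 2 ^ (c : ℕ) < T.card * 2 ^ h + ∑ c ∈ T, 2 ^ (c : ℕ)})} =>
      fun j : Fin r => if T.1 ⊆ w j then (1 : ℂ) else 0) := by
    rw [← span_std_eq_top w hw]
    refine Submodule.span_le.mpr ?_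
    rintro _ ⟨T, hT, rfl⟩
    exact Submodule.subset_span ⟨⟨T, hT⟩, rfl⟩
  let b := Module.Basis.mk (std_linearIndependent w) hsp
  have e := Module.finrank_eq_card_basis b
  rw [Module.finrank_fin_fun] at e
  exact e.symm

/-! ## 4. The down-closed monomial basis -/

open Classical in
/-- **A down-closed monomial basis for arbitrary columns.**  For every injective
`w : Fin r → Finset (Fin h)` there is an injective `U : Fin r → Finset (Fin h)` whose image is closed
under taking subsets and whose `0/1` matrix `[U i ⊆ w j]` (the square-free monomials `z_{U i}`
evaluated at the columns) has nonzero determinant. -/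
theorem exists_downClosed_monomialBasis (w : Fin r → Finset (Fin h)) (hw : Function.Injective w) :
    ∃ U : Fin r → Finset (Fin h), Function.Injective U ∧
      (∀ i (S : Finset (Fin h)), S ⊆ U i → ∃ i', U i' = S) ∧
      (Matrix.of fun i j : Fin r => if U i ⊆ w j then (1 : ℂ) else 0).det ≠ 0 := by
  set ι := {T : Finset (Fin h) //
        (fun j : Fin r => if T ⊆ w j then (1 : ℂ) else 0) ∉ Submodule.span ℂ
          ((fun S' : Finset (Fin h) => fun j : Fin r => if S' ⊆ w j then (1 : ℂ) else 0) ''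
            {T' | T'.card * 2 ^ h + ∑ c ∈ T', 2 ^ (c : ℕ) < T.card * 2 ^ h + ∑ c ∈ T, 2 ^ (c : ℕ)})}
  have hcard : Fintype.card ι = r := card_std w hw
  let e : Fin r ≃ ι := (Fintype.equivFinOfCardEq hcard).symm
  refine ⟨fun i => (e i).1, Subtype.val_injective.comp e.injective, ?_, ?_⟩
  · intro i S hS
    have hstd : (fun j : Fin r => if S ⊆ w j then (1 : ℂ) else 0) ∉ Submodule.span ℂ
        ((fun S' : Finset (Fin h) => fun j : Fin r => if S' ⊆ w j then (1 : ℂ) else 0) ''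
          {T' | T'.card * 2 ^ h + ∑ c ∈ T', 2 ^ (c : ℕ) < S.card * 2 ^ h + ∑ c ∈ S, 2 ^ (c : ℕ)}) :=
      fun hN => (e i).2 (nonStd_mono w hN hS)
    refine ⟨e.symm ⟨S, hstd⟩, ?_⟩
    simp
  · have hli : LinearIndependent ℂ (fun i : Fin r => fun j : Fin r => if (e i).1 ⊆ w j then (1 : ℂ) else 0) :=
      (std_linearIndependent w).comp e e.injective
    have hrows : LinearIndependent ℂ
        (Matrix.of fun i j : Fin r => if (e i).1 ⊆ w j then (1 : ℂ) else 0).row := by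
      have e2 : (Matrix.of fun i j : Fin r => if (e i).1 ⊆ w j then (1 : ℂ) else 0).row =
          fun i : Fin r => fun j : Fin r => if (e i).1 ⊆ w j then (1 : ℂ) else 0 := by
        funext i j
        rfl
      rw [e2]
      exact hli
    have hU := Matrix.linearIndependent_rows_iff_isUnit.mp hrows
    exact ((Matrix.isUnit_iff_isUnit_det _).mp hU).ne_zero

end Summit.ValiantsHypothesis.ValiantsHypothesis.Theorems.BarrierLever.ChowThinAll
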